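import Mathlib
import HarnessLib

/-!
# Schur orthogonality relations for compact groups

Topic `Literature/RepresentationTheory/CompactGroups`; namespace `Literature.RepresentationTheory.CompactGroups.Schur`.
Theorems, one auxiliary definition (`Schur.avg`, the averaged operator) and no named fact.

T. Bröcker, T. tom Dieck, *Representations of Compact Lie Groups* (GTM 98, 1985), Ch. II §4 (PDF pp. 76–78):
(4.1)–(4.2) for an irreducible `V` and `f ∈ Hom(V, V)`, `∫ g·f dg = |V|⁻¹ Tr(f) id_V` (`g·f = l_g ∘ f ∘ l_g⁻¹`);
(4.5) **Orthogonality Relations** (i) `∫ ⟨g f(g⁻¹ v), w⟩ dg = |V|⁻¹ Tr(f) ⟨v, w⟩`, (ii) for unitary `V`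
`∫ conj⟨gα, v⟩ ⟨gβ, w⟩ dg = |V|⁻¹ conj⟨α, β⟩ ⟨v, w⟩`; (4.6) for non-isomorphic irreducible `V`, `W`,
`∫ conj⟨gα, v⟩ ⟨gβ, w⟩ dg = 0`; (4.8) the matrix coefficients `r_{ij}(g, V) = ⟨g v_j, v_i⟩` of irreducible unitary
representations in orthonormal bases satisfy `∫ r_{ij}(g,V) conj r_{kl}(g,V) = |V|⁻¹ δ_{ik} δ_{jl}` and
`∫ r_{ij}(g,V) conj r_{kl}(g,W) = 0` for `V ≇ W`; (4.9)–(4.11) characters `χ_V(g) = Tr(l_g)` and their orthonormality.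
Also G. B. Folland, *A Course in Abstract Harmonic Analysis* (1995), Thm. 5.8 (Schur orthogonality relations).

Typing.  `G` is a compact group with a Borel σ-algebra and a left-invariant probability measure `μ` (the normalised
Haar measure); `E`, `F` are finite-dimensional complex inner product spaces carrying representations
`π : ContRepresentation ℂ G E`, `σ : ContRepresentation ℂ G F` (Mathlib), norm-continuous in `g` — for finite-dimensional
`E` this is the same as strong continuity (`Schur.continuous_of_forall_continuous_apply`).  Irreducibility is Mathlib's
`Representation.IsIrreducible` of `π.toRepresentation` (no proper non-zero invariant subspace), unitarity the identity
`⟪π g v, π g w⟫ = ⟪v, w⟫`, and "`V ≇ W`" is `IsEmpty (π.toRepresentation.Equiv σ.toRepresentation)`.  Mathlib's inner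
product is conjugate-linear in the FIRST variable, so Bröcker–tom Dieck's `⟨x, y⟩` is Mathlib's `⟪y, x⟫`.

* `Schur.avg μ π σ f = ∫ σ g ∘ f ∘ π g⁻¹ dμ(g)` (a Bochner integral in `E →L[ℂ] F`) and `Schur.comp_avg`: it intertwines,
  `σ x ∘ avg f = avg f ∘ π x` (left invariance of `μ`) — Bröcker–tom Dieck (4.1);
* `Schur.avg_eq_zero_of_isEmpty_equiv` — for irreducible non-isomorphic `π`, `σ` every averaged operator vanishes
  (Mathlib's Schur lemma `Representation.IsIrreducible.bijective_or_eq_zero`) — the operator behind (4.6);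
* `Schur.avg_eq_smul_one` — **(4.2)**: for irreducible `π`, `avg f = (Tr f / dim E) • 1` (Mathlib's
  `algebraMap_intertwiningMap_bijective_of_isAlgClosed`: intertwiners of an irreducible representation over `ℂ` are scalars;
  the scalar is read off by taking traces under the integral);
* `Schur.integral_inner_conj_apply` — **(4.5) (i)**; `Schur.integral_conj_inner_mul_inner` — **(4.5) (ii)** for unitary `π`:
  `∫ conj⟪v, π g α⟫ ⟪w, π g β⟫ dμ = ⟪α, β⟫ ⟪w, v⟫ / dim E`;
* `Schur.integral_conj_inner_mul_inner_eq_zero` — **(4.6)**: `∫ conj⟪v, π g α⟫ ⟪w, σ g β⟫ dμ = 0` for `π ≇ σ`;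
* `Schur.integral_coeff_mul_conj_coeff` / `Schur.integral_coeff_mul_conj_coeff_eq_zero` — **(4.8)** for the matrix
  coefficients `⟪b i, π g (b j)⟫` in orthonormal bases;
* `Schur.character π g = Tr(π g)` with `character_eq_sum_inner`, and **(4.11)-type orthonormality of irreducible
  characters**: `Schur.integral_conj_character_mul_character_eq_zero` (`π ≇ σ`) and
  `Schur.integral_normSq_character` (`∫ |χ_π|² dμ = 1` for irreducible unitary `π`).

Mathlib has Schur's lemma (`Representation.IsIrreducible`), characters and their orthogonality for FINITE groups
(`FDRep.char_orthonormal`) and the Haar measure, but no orthogonality relations for compact groups; the tree's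
`IsotypicProjection` / `CompactLocalFactor` treat one-dimensional characters only.

## References
* T. Bröcker, T. tom Dieck, *Representations of Compact Lie Groups*, GTM 98 (1985), II (4.1)–(4.11), PDF pp. 76–79
  [BrockerTomDieck1985].
* G. B. Folland, *A Course in Abstract Harmonic Analysis* (1995), §5.2, Thm. 5.8 [Folland1995].

## Provenance
Lane `lit-hodgefound` (HOME `run/shared/lean/pub/lit-hodgefound/`), prover seat `lit-hodgefound-p05` generation 6 (Layer 0:
compact groups beneath the `K`-type statements of the unitary-group / theta layer).
-/

noncomputable section

open MeasureTheory ContinuousLinearMap Complex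
open scoped InnerProductSpace ComplexConjugate

namespace Literature.RepresentationTheory.CompactGroups

namespace Schur

/-! ### Strong continuity is norm continuity in finite dimension -/

/-- **Strong continuity is norm continuity for finite-dimensional representations**: if every orbit map
`g ↦ π g v` is continuous then `g ↦ π g` is continuous into `E →L[ℂ] F` with its operator norm (the norm is controlled
by the values on a basis, Mathlib `Basis.exists_opNorm_le`).  So the norm-continuity hypotheses below are the tree's
`ContRepresentation.IsStronglyContinuous`. [cite: BrockerTomDieck1985, II (4.1)] -/
theorem continuous_of_forall_continuous_apply {X : Type*} [TopologicalSpace X] {E F : Type*}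
    [NormedAddCommGroup E] [NormedSpace ℂ E] [FiniteDimensional ℂ E] [NormedAddCommGroup F] [NormedSpace ℂ F]
    {π : X → E →L[ℂ] F} (hπ : ∀ v, Continuous fun g => π g v) : Continuous π := by
  classical
  obtain ⟨C, hC, hle⟩ := (Module.finBasis ℂ E).exists_opNorm_le (F := F)
  refine continuous_iff_continuousAt.mpr fun g₀ => ?_
  rw [ContinuousAt, Metric.tendsto_nhds]
  intro ε hε
  have hε' : 0 < ε / (2 * C) := by positivity
  have hev : ∀ᶠ g in nhds g₀, ∀ i,
      ‖π g (Module.finBasis ℂ E i) - π g₀ (Module.finBasis ℂ E i)‖ ≤ ε / (2 * C) := by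
    refine Filter.eventually_all.mpr fun i => ?_
    have h := (hπ (Module.finBasis ℂ E i)).continuousAt (x := g₀)
    rw [ContinuousAt, Metric.tendsto_nhds] at h
    exact (h _ hε').mono fun g hg => by rw [dist_eq_norm] at hg; exact hg.le
  refine hev.mono fun g hg => ?_
  rw [dist_eq_norm]
  calc ‖π g - π g₀‖ ≤ C * (ε / (2 * C)) := hle hε'.le fun i => by simpa using hg i
    _ = ε / 2 := by field_simp
    _ < ε := half_lt_self hε

variable {G : Type*} [Group G] [TopologicalSpace G] [IsTopologicalGroup G] [MeasurableSpace G] [BorelSpace G]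
  [CompactSpace G]
variable {E F : Type*} [NormedAddCommGroup E] [InnerProductSpace ℂ E] [FiniteDimensional ℂ E]
  [NormedAddCommGroup F] [InnerProductSpace ℂ F] [FiniteDimensional ℂ F]
variable (μ : Measure G) [IsProbabilityMeasure μ] [μ.IsMulLeftInvariant]
variable {π : ContRepresentation ℂ G E} {σ : ContRepresentation ℂ G F}

/-! ### The averaged operator `∫ σ g ∘ f ∘ π g⁻¹ dg` -/

variable (π σ) in
/-- **The averaged operator** `avg f = ∫_G σ g ∘ f ∘ π g⁻¹ dμ(g)` of `f : E → F` (Bröcker–tom Dieck II (4.1): the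
projection `Hom(V, W) → Hom_G(V, W)`, `f ↦ ∫ g·f dg`), a Bochner integral in the finite-dimensional space `E →L[ℂ] F`.
[cite: BrockerTomDieck1985, II (4.1)] -/
def avg (f : E →L[ℂ] F) : E →L[ℂ] F :=
  ∫ g, (σ g).comp (f.comp (π g⁻¹)) ∂μ

omit [IsTopologicalGroup G] [MeasurableSpace G] [BorelSpace G] [CompactSpace G] [FiniteDimensional ℂ E]
  [FiniteDimensional ℂ F] in
/-- The conjugated operator `g ↦ σ g ∘ f ∘ π g⁻¹` is norm-continuous. [cite: BrockerTomDieck1985, II (4.1)] -/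
theorem continuous_conjOp [ContinuousInv G] (hπ : Continuous (π : G → E →L[ℂ] E))
    (hσ : Continuous (σ : G → F →L[ℂ] F)) (f : E →L[ℂ] F) :
    Continuous fun g : G => (σ g).comp (f.comp (π g⁻¹)) :=
  hσ.clm_comp (continuous_const.clm_comp (hπ.comp continuous_inv))

omit [FiniteDimensional ℂ E] [FiniteDimensional ℂ F] [μ.IsMulLeftInvariant] in
/-- … hence Bochner integrable on the compact group. [cite: BrockerTomDieck1985, II (4.1)] -/
theorem integrable_conjOp (hπ : Continuous (π : G → E →L[ℂ] E)) (hσ : Continuous (σ : G → F →L[ℂ] F))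
    (f : E →L[ℂ] F) : Integrable (fun g : G => (σ g).comp (f.comp (π g⁻¹))) μ :=
  (continuous_conjOp hπ hσ f).integrable_of_hasCompactSupport (HasCompactSupport.of_compactSpace _)

omit [TopologicalSpace G] [IsTopologicalGroup G] [MeasurableSpace G] [BorelSpace G] [CompactSpace G]
  [FiniteDimensional ℂ E] in
/-- `π x⁻¹ (π x v) = v`. [cite: BrockerTomDieck1985, II (4.1)] -/
theorem apply_inv_apply (x : G) (v : E) : π x⁻¹ (π x v) = v := by
  rw [← ContinuousLinearMap.comp_apply, ← ContinuousLinearMap.mul_def, ← map_mul, inv_mul_cancel, map_one]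
  rfl

omit [TopologicalSpace G] [IsTopologicalGroup G] [MeasurableSpace G] [BorelSpace G] [CompactSpace G]
  [FiniteDimensional ℂ E] in
/-- `π x (π x⁻¹ v) = v`. [cite: BrockerTomDieck1985, II (4.1)] -/
theorem apply_apply_inv (x : G) (v : E) : π x (π x⁻¹ v) = v := by
  rw [← ContinuousLinearMap.comp_apply, ← ContinuousLinearMap.mul_def, ← map_mul, mul_inv_cancel, map_one]
  rfl

omit [FiniteDimensional ℂ E] in
/-- **The averaged operator intertwines**: `σ x ∘ avg f = avg f ∘ π x` (Bröcker–tom Dieck II (4.1): `x p(f) = p(f)` for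
the conjugation action, by left invariance of the integral: `σ x σ g f π g⁻¹ = σ (xg) f π (xg)⁻¹ π x`).
[cite: BrockerTomDieck1985, II (4.1)] -/
theorem comp_avg (hπ : Continuous (π : G → E →L[ℂ] E)) (hσ : Continuous (σ : G → F →L[ℂ] F)) (f : E →L[ℂ] F)
    (x : G) : (σ x).comp (avg μ π σ f) = (avg μ π σ f).comp (π x) := by
  haveI : CompleteSpace F := FiniteDimensional.complete ℂ F
  unfold avg
  have hint := integrable_conjOp μ hπ hσ f
  have h1 : (σ x).comp (∫ g, (σ g).comp (f.comp (π g⁻¹)) ∂μ) = ∫ g, (σ x).comp ((σ g).comp (f.comp (π g⁻¹))) ∂μ := by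
    simpa only [ContinuousLinearMap.compL_apply] using
      (((ContinuousLinearMap.compL ℂ E F F) (σ x)).integral_comp_comm hint).symm
  have h2 : (∫ g, (σ g).comp (f.comp (π g⁻¹)) ∂μ).comp (π x) = ∫ g, ((σ g).comp (f.comp (π g⁻¹))).comp (π x) ∂μ := by
    simpa only [ContinuousLinearMap.compL_apply, ContinuousLinearMap.flip_apply] using
      ((((ContinuousLinearMap.compL ℂ E E F).flip (π x))).integral_comp_comm hint).symm
  rw [h1, h2]
  have key : ∀ g : G, (σ x).comp ((σ g).comp (f.comp (π g⁻¹))) =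
      (fun g : G => (σ g).comp (f.comp ((π g⁻¹).comp (π x)))) (x * g) := by
    intro g
    refine ContinuousLinearMap.ext fun v => ?_
    simp only [map_mul, mul_inv_rev, ContinuousLinearMap.mul_def, ContinuousLinearMap.comp_apply,
      apply_inv_apply]
  calc ∫ g, (σ x).comp ((σ g).comp (f.comp (π g⁻¹))) ∂μ
      = ∫ g, (fun g : G => (σ g).comp (f.comp ((π g⁻¹).comp (π x)))) (x * g) ∂μ :=
        integral_congr_ae (Filter.Eventually.of_forall key)
    _ = ∫ g, (σ g).comp (f.comp ((π g⁻¹).comp (π x))) ∂μ :=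
        integral_mul_left_eq_self (μ := μ) (fun g : G => (σ g).comp (f.comp ((π g⁻¹).comp (π x)))) x
    _ = ∫ g, ((σ g).comp (f.comp (π g⁻¹))).comp (π x) ∂μ := by
        simp only [ContinuousLinearMap.comp_assoc]

/-- The averaged operator as a Mathlib intertwining map `π.toRepresentation → σ.toRepresentation`.
[cite: BrockerTomDieck1985, II (4.1)] -/
def avgIntertwining (hπ : Continuous (π : G → E →L[ℂ] E)) (hσ : Continuous (σ : G → F →L[ℂ] F))
    (f : E →L[ℂ] F) : Representation.IntertwiningMap π.toRepresentation σ.toRepresentation where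
  toLinearMap := (avg μ π σ f : E →L[ℂ] F)
  isIntertwining' g := by
    refine LinearMap.ext fun v => ?_
    have h := congrArg (fun T : E →L[ℂ] F => T v) (comp_avg μ hπ hσ f g)
    exact h.symm

omit [FiniteDimensional ℂ E] in
/-- Unfolding `avgIntertwining`. [cite: BrockerTomDieck1985, II (4.1)] -/
@[simp] theorem avgIntertwining_apply (hπ : Continuous (π : G → E →L[ℂ] E))
    (hσ : Continuous (σ : G → F →L[ℂ] F)) (f : E →L[ℂ] F) (v : E) :
    avgIntertwining μ hπ hσ f v = avg μ π σ f v := rfl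

/-! ### Schur's lemma applied to the averaged operator -/

omit [FiniteDimensional ℂ E] in
/-- **Non-isomorphic irreducibles: every averaged operator vanishes** (Bröcker–tom Dieck II (4.6), operator form;
Schur's lemma, Mathlib `Representation.IsIrreducible.bijective_or_eq_zero`: a non-zero intertwiner between
irreducibles is an isomorphism). [cite: BrockerTomDieck1985, II (4.6)] -/
theorem avg_eq_zero_of_isEmpty_equiv (hπ : Continuous (π : G → E →L[ℂ] E)) (hσ : Continuous (σ : G → F →L[ℂ] F))
    [π.toRepresentation.IsIrreducible] [σ.toRepresentation.IsIrreducible]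
    (hne : IsEmpty (π.toRepresentation.Equiv σ.toRepresentation)) (f : E →L[ℂ] F) : avg μ π σ f = 0 := by
  rcases Representation.IsIrreducible.bijective_or_eq_zero (avgIntertwining μ hπ hσ f) with h | h
  · exact (hne.false ((avgIntertwining μ hπ hσ f).ofBijective h)).elim
  · ext v
    have hv := congrArg (fun T : Representation.IntertwiningMap π.toRepresentation σ.toRepresentation => T v) h
    exact hv

variable (π) in
omit [TopologicalSpace G] [IsTopologicalGroup G] [MeasurableSpace G] [BorelSpace G] [CompactSpace G] in
/-- Irreducible representations live on non-trivial spaces, so `dim E ≠ 0`. [cite: BrockerTomDieck1985, II (4.2)] -/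
theorem finrank_ne_zero_of_isIrreducible [π.toRepresentation.IsIrreducible] : (Module.finrank ℂ E : ℂ) ≠ 0 := by
  haveI : Nontrivial E := IsSimpleModule.nontrivial (MonoidAlgebra ℂ G) π.toRepresentation.asModule
  exact_mod_cast Module.finrank_pos.ne'

omit [TopologicalSpace G] [IsTopologicalGroup G] [MeasurableSpace G] [BorelSpace G] [CompactSpace G]
  [FiniteDimensional ℂ E] in
/-- `π g⁻¹ ∘ π g = id` at the level of linear maps. [cite: BrockerTomDieck1985, II (4.2)] -/
theorem toLinearMap_inv_comp (g : G) :
    (π g⁻¹ : E →ₗ[ℂ] E) ∘ₗ (π g : E →ₗ[ℂ] E) = LinearMap.id := by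
  refine LinearMap.ext fun v => ?_
  simp only [LinearMap.comp_apply, ContinuousLinearMap.coe_coe, LinearMap.id_apply, apply_inv_apply]

omit [TopologicalSpace G] [IsTopologicalGroup G] [MeasurableSpace G] [BorelSpace G] [CompactSpace G] in
/-- The trace of the conjugated operator: `Tr(π g ∘ f ∘ π g⁻¹) = Tr f`. [cite: BrockerTomDieck1985, II (4.2)] -/
theorem trace_conjOp (f : E →L[ℂ] E) (g : G) :
    LinearMap.trace ℂ E ((π g : E →ₗ[ℂ] E) ∘ₗ ((f : E →ₗ[ℂ] E) ∘ₗ (π g⁻¹ : E →ₗ[ℂ] E))) =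
      LinearMap.trace ℂ E (f : E →ₗ[ℂ] E) := by
  rw [LinearMap.trace_comp_comm', LinearMap.comp_assoc, toLinearMap_inv_comp, LinearMap.comp_id]

variable (E) in
/-- The trace as a continuous linear functional on `E →L[ℂ] E` (finite dimension). [cite: BrockerTomDieck1985, II (4.2)] -/
def traceCLM : (E →L[ℂ] E) →L[ℂ] ℂ :=
  LinearMap.toContinuousLinearMap ((LinearMap.trace ℂ E) ∘ₗ (ContinuousLinearMap.coeLM ℂ))

omit [TopologicalSpace G] [IsTopologicalGroup G] [MeasurableSpace G] [BorelSpace G] [CompactSpace G] in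
/-- Unfolding `traceCLM`. [cite: BrockerTomDieck1985, II (4.2)] -/
@[simp] theorem traceCLM_apply (f : E →L[ℂ] E) : traceCLM E f = LinearMap.trace ℂ E (f : E →ₗ[ℂ] E) := rfl

/-- **Bröcker–tom Dieck II (4.2)**: for an irreducible `π` and any operator `f` on `E`,
`∫ π g ∘ f ∘ π g⁻¹ dμ(g) = (Tr f / dim E) • 1` — the averaged operator is an intertwiner, hence a scalar by Schur's
lemma (`ℂ` algebraically closed, Mathlib `Representation.IsIrreducible.algebraMap_intertwiningMap_bijective_of_isAlgClosed`),
and its trace is `∫ Tr(π g f π g⁻¹) = Tr f`. [cite: BrockerTomDieck1985, II (4.2)] -/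
theorem avg_eq_smul_one (hπ : Continuous (π : G → E →L[ℂ] E)) [π.toRepresentation.IsIrreducible] (f : E →L[ℂ] E) :
    avg μ π π f = (LinearMap.trace ℂ E (f : E →ₗ[ℂ] E) / (Module.finrank ℂ E : ℂ)) • (1 : E →L[ℂ] E) := by
  haveI : CompleteSpace E := FiniteDimensional.complete ℂ E
  -- Schur: the intertwiner `avg f` is a scalar `c`
  obtain ⟨c, hc⟩ :=
    (Representation.IsIrreducible.algebraMap_intertwiningMap_bijective_of_isAlgClosed
      (ρ := π.toRepresentation)).2 (avgIntertwining μ hπ hπ f)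
  have hv : ∀ v : E, avg μ π π f v = c • v := fun v => by
    have h := congrArg (fun T : Representation.IntertwiningMap π.toRepresentation π.toRepresentation => T v) hc
    exact h.symm
  have havg : avg μ π π f = c • (1 : E →L[ℂ] E) := by
    ext v
    exact hv v
  -- read off `c` from the trace
  have htr : LinearMap.trace ℂ E ((avg μ π π f : E →L[ℂ] E) : E →ₗ[ℂ] E) = LinearMap.trace ℂ E (f : E →ₗ[ℂ] E) := by
    rw [← traceCLM_apply, avg, ← (traceCLM E).integral_comp_comm (integrable_conjOp μ hπ hπ f)]
    simp [trace_conjOp]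
  rw [havg, ContinuousLinearMap.toLinearMap_smul, map_smul, ContinuousLinearMap.toLinearMap_one, LinearMap.trace_one,
    smul_eq_mul] at htr
  rw [havg, ← htr, mul_div_assoc, div_self (finrank_ne_zero_of_isIrreducible π), mul_one]

/-! ### The orthogonality relations (4.5), (4.6) -/

omit [FiniteDimensional ℂ E] [μ.IsMulLeftInvariant] in
/-- Scalar matrix coefficients of the conjugated operator pass under the integral:
`∫ ⟪w, σ g (f (π g⁻¹ v))⟫ dμ = ⟪w, (avg f) v⟫`. [cite: BrockerTomDieck1985, II (4.4)] -/
theorem integral_inner_conjOp_apply (hπ : Continuous (π : G → E →L[ℂ] E)) (hσ : Continuous (σ : G → F →L[ℂ] F))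
    (f : E →L[ℂ] F) (v : E) (w : F) :
    ∫ g, ⟪w, σ g (f (π g⁻¹ v))⟫_ℂ ∂μ = ⟪w, avg μ π σ f v⟫_ℂ := by
  haveI : CompleteSpace F := FiniteDimensional.complete ℂ F
  have h := ((innerSL ℂ w).comp (ContinuousLinearMap.apply ℂ F v)).integral_comp_comm (integrable_conjOp μ hπ hσ f)
  simp only [ContinuousLinearMap.comp_apply, ContinuousLinearMap.apply_apply, innerSL_apply_apply] at h
  rw [h, avg]

/-- **Bröcker–tom Dieck II (4.5) (i)**: for irreducible `π`, any operator `f` and `v, w ∈ E`,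
`∫ ⟪w, π g (f (π g⁻¹ v))⟫ dμ(g) = (Tr f / dim E) ⟪w, v⟫`. [cite: BrockerTomDieck1985, II Thm (4.5)(i)] -/
theorem integral_inner_conj_apply (hπ : Continuous (π : G → E →L[ℂ] E)) [π.toRepresentation.IsIrreducible]
    (f : E →L[ℂ] E) (v w : E) :
    ∫ g, ⟪w, π g (f (π g⁻¹ v))⟫_ℂ ∂μ =
      LinearMap.trace ℂ E (f : E →ₗ[ℂ] E) / (Module.finrank ℂ E : ℂ) * ⟪w, v⟫_ℂ := by
  rw [integral_inner_conjOp_apply μ hπ hπ f v w, avg_eq_smul_one μ hπ f]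
  show ⟪w, (LinearMap.trace ℂ E (f : E →ₗ[ℂ] E) / (Module.finrank ℂ E : ℂ)) • v⟫_ℂ = _
  rw [inner_smul_right]

omit [TopologicalSpace G] [IsTopologicalGroup G] [MeasurableSpace G] [BorelSpace G] [CompactSpace G]
  [FiniteDimensional ℂ E] in
/-- For a unitary `π`: `⟪α, π g⁻¹ v⟫ = conj ⟪v, π g α⟫`. [cite: BrockerTomDieck1985, II Thm (4.5)(ii)] -/
theorem inner_apply_inv_eq_conj (hu : ∀ (g : G) (v w : E), ⟪π g v, π g w⟫_ℂ = ⟪v, w⟫_ℂ) (g : G) (α v : E) :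
    ⟪α, π g⁻¹ v⟫_ℂ = conj ⟪v, π g α⟫_ℂ := by
  rw [← hu g α (π g⁻¹ v), apply_apply_inv, inner_conj_symm]

omit [TopologicalSpace G] [IsTopologicalGroup G] [MeasurableSpace G] [BorelSpace G] [CompactSpace G] in
/-- The trace of the rank-one operator `u ↦ ⟪α, u⟫ β` on `E` is `⟪α, β⟫` (Bröcker–tom Dieck II (3.2)).
[cite: BrockerTomDieck1985, II (3.2)] -/
theorem trace_rankOne (α β : E) :
    LinearMap.trace ℂ E (((innerSL ℂ α).smulRight β : E →L[ℂ] E) : E →ₗ[ℂ] E) = ⟪α, β⟫_ℂ := by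
  have h : (((innerSL ℂ α).smulRight β : E →L[ℂ] E) : E →ₗ[ℂ] E) =
      ((innerSL ℂ α : E →L[ℂ] ℂ) : E →ₗ[ℂ] ℂ).smulRight β := by
    ext u
    simp
  rw [h, LinearMap.trace_smulRight]
  simp

/-- **Bröcker–tom Dieck II (4.5) (ii) — Schur orthogonality within one irreducible unitary representation**:
`∫ conj⟪v, π g α⟫ ⟪w, π g β⟫ dμ(g) = ⟪α, β⟫ ⟪w, v⟫ / dim E` (Folland Thm. 5.8).
[cite: BrockerTomDieck1985, II Thm (4.5)(ii)] [cite: Folland1995, Thm 5.8] -/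
theorem integral_conj_inner_mul_inner (hπ : Continuous (π : G → E →L[ℂ] E)) [π.toRepresentation.IsIrreducible]
    (hu : ∀ (g : G) (v w : E), ⟪π g v, π g w⟫_ℂ = ⟪v, w⟫_ℂ) (α β v w : E) :
    ∫ g, conj ⟪v, π g α⟫_ℂ * ⟪w, π g β⟫_ℂ ∂μ = ⟪α, β⟫_ℂ * ⟪w, v⟫_ℂ / (Module.finrank ℂ E : ℂ) := by
  have h := integral_inner_conj_apply μ hπ ((innerSL ℂ α).smulRight β) v w
  simp only [ContinuousLinearMap.smulRight_apply, innerSL_apply_apply, map_smul, inner_smul_right,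
    inner_apply_inv_eq_conj hu] at h
  rw [h, trace_rankOne, div_mul_eq_mul_div]

omit [FiniteDimensional ℂ E] in
/-- **Bröcker–tom Dieck II (4.6) — Schur orthogonality between non-isomorphic irreducibles**: for irreducible `π`
(unitary) and `σ` with `π ≇ σ`, `∫ conj⟪v, π g α⟫ ⟪w, σ g β⟫ dμ(g) = 0` (Folland Thm. 5.8).
[cite: BrockerTomDieck1985, II Thm (4.6)] [cite: Folland1995, Thm 5.8] -/
theorem integral_conj_inner_mul_inner_eq_zero (hπ : Continuous (π : G → E →L[ℂ] E))
    (hσ : Continuous (σ : G → F →L[ℂ] F)) [π.toRepresentation.IsIrreducible] [σ.toRepresentation.IsIrreducible]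
    (hne : IsEmpty (π.toRepresentation.Equiv σ.toRepresentation))
    (hu : ∀ (g : G) (v w : E), ⟪π g v, π g w⟫_ℂ = ⟪v, w⟫_ℂ) (α v : E) (β w : F) :
    ∫ g, conj ⟪v, π g α⟫_ℂ * ⟪w, σ g β⟫_ℂ ∂μ = 0 := by
  have h := integral_inner_conjOp_apply μ hπ hσ ((innerSL ℂ α).smulRight β) v w
  simp only [ContinuousLinearMap.smulRight_apply, innerSL_apply_apply, map_smul, inner_smul_right,
    inner_apply_inv_eq_conj hu, avg_eq_zero_of_isEmpty_equiv μ hπ hσ hne] at h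
  simpa using h

/-! ### Matrix coefficients in orthonormal bases (4.8) -/

/-- **Bröcker–tom Dieck II (4.8), one representation**: the matrix coefficients `r_{ij}(g) = ⟪b i, π g (b j)⟫` of an
irreducible unitary representation in an orthonormal basis `b` satisfy
`∫ conj r_{kl}(g) r_{ij}(g) dμ(g) = δ_{ik} δ_{jl} / dim E`. [cite: BrockerTomDieck1985, II (4.8)] -/
theorem integral_conj_coeff_mul_coeff {ι : Type*} [Fintype ι] [DecidableEq ι] (b : OrthonormalBasis ι ℂ E)
    (hπ : Continuous (π : G → E →L[ℂ] E)) [π.toRepresentation.IsIrreducible]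
    (hu : ∀ (g : G) (v w : E), ⟪π g v, π g w⟫_ℂ = ⟪v, w⟫_ℂ) (i j k l : ι) :
    ∫ g, conj ⟪b k, π g (b l)⟫_ℂ * ⟪b i, π g (b j)⟫_ℂ ∂μ =
      if i = k ∧ j = l then 1 / (Module.finrank ℂ E : ℂ) else 0 := by
  rw [integral_conj_inner_mul_inner μ hπ hu, orthonormal_iff_ite.mp b.orthonormal l j,
    orthonormal_iff_ite.mp b.orthonormal i k]
  by_cases hik : i = k <;> by_cases hjl : j = l <;> simp [hik, hjl, eq_comm]

omit [FiniteDimensional ℂ E] in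
/-- **Bröcker–tom Dieck II (4.8), two non-isomorphic representations**: matrix coefficients of non-isomorphic
irreducible representations (the first unitary) are orthogonal: `∫ conj⟪b k, π g (b l)⟫ ⟪c i, σ g (c j)⟫ dμ = 0`.
[cite: BrockerTomDieck1985, II (4.8)] -/
theorem integral_conj_coeff_mul_coeff_eq_zero {ι κ : Type*} [Fintype ι] [Fintype κ] (b : OrthonormalBasis ι ℂ E)
    (c : OrthonormalBasis κ ℂ F) (hπ : Continuous (π : G → E →L[ℂ] E)) (hσ : Continuous (σ : G → F →L[ℂ] F))
    [π.toRepresentation.IsIrreducible] [σ.toRepresentation.IsIrreducible]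
    (hne : IsEmpty (π.toRepresentation.Equiv σ.toRepresentation))
    (hu : ∀ (g : G) (v w : E), ⟪π g v, π g w⟫_ℂ = ⟪v, w⟫_ℂ) (k l : ι) (i j : κ) :
    ∫ g, conj ⟪b k, π g (b l)⟫_ℂ * ⟪c i, σ g (c j)⟫_ℂ ∂μ = 0 :=
  integral_conj_inner_mul_inner_eq_zero μ hπ hσ hne hu (b l) (b k) (c j) (c i)

/-! ### Characters (4.9)–(4.11) -/

variable (π) in
/-- The **character** `χ_π(g) = Tr(π g)` of a finite-dimensional representation (Bröcker–tom Dieck II (4.9)).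
[cite: BrockerTomDieck1985, II Def (4.9)] -/
def character (g : G) : ℂ := LinearMap.trace ℂ E ((π g : E →L[ℂ] E) : E →ₗ[ℂ] E)

omit [TopologicalSpace G] [IsTopologicalGroup G] [MeasurableSpace G] [BorelSpace G] [CompactSpace G]
  [FiniteDimensional ℂ E] in
/-- The character in an orthonormal basis: `χ_π(g) = Σ_i ⟪b i, π g (b i)⟫` (sum of diagonal matrix coefficients).
[cite: BrockerTomDieck1985, II Def (4.9)] -/
theorem character_eq_sum_inner {ι : Type*} [Fintype ι] (b : OrthonormalBasis ι ℂ E) (g : G) :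
    character π g = ∑ i, ⟪b i, π g (b i)⟫_ℂ :=
  LinearMap.trace_eq_sum_inner _ b

omit [IsTopologicalGroup G] [MeasurableSpace G] [BorelSpace G] [CompactSpace G] [FiniteDimensional ℂ E] in
/-- Matrix coefficients `g ↦ ⟪v, π g w⟫` are continuous. [cite: BrockerTomDieck1985, II (4.3)] -/
theorem continuous_inner_apply (hπ : Continuous (π : G → E →L[ℂ] E)) (v w : E) :
    Continuous fun g : G => ⟪v, π g w⟫_ℂ :=
  continuous_const.inner ((ContinuousLinearMap.apply ℂ E w).continuous.comp hπ)

omit [IsTopologicalGroup G] [FiniteDimensional ℂ E] [FiniteDimensional ℂ F] [μ.IsMulLeftInvariant] in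
/-- Products of matrix coefficients are integrable on the compact group. [cite: BrockerTomDieck1985, II (4.7)] -/
theorem integrable_conj_inner_mul_inner (hπ : Continuous (π : G → E →L[ℂ] E))
    (hσ : Continuous (σ : G → F →L[ℂ] F)) (α v : E) (β w : F) :
    Integrable (fun g : G => conj ⟪v, π g α⟫_ℂ * ⟪w, σ g β⟫_ℂ) μ :=
  ((continuous_conj.comp (continuous_inner_apply hπ v α)).mul
    (continuous_inner_apply hσ w β)).integrable_of_hasCompactSupport (HasCompactSupport.of_compactSpace _)

/-- **Orthogonality of irreducible characters, distinct classes** (from Bröcker–tom Dieck II (4.8) summed over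
orthonormal bases): for non-isomorphic irreducible `π` (unitary), `σ`: `∫ conj χ_π(g) χ_σ(g) dμ(g) = 0`.
[cite: BrockerTomDieck1985, II (4.8)] -/
theorem integral_conj_character_mul_character_eq_zero (hπ : Continuous (π : G → E →L[ℂ] E))
    (hσ : Continuous (σ : G → F →L[ℂ] F)) [π.toRepresentation.IsIrreducible] [σ.toRepresentation.IsIrreducible]
    (hne : IsEmpty (π.toRepresentation.Equiv σ.toRepresentation))
    (hu : ∀ (g : G) (v w : E), ⟪π g v, π g w⟫_ℂ = ⟪v, w⟫_ℂ) :
    ∫ g, conj (character π g) * character σ g ∂μ = 0 := by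
  classical
  simp only [character_eq_sum_inner (stdOrthonormalBasis ℂ E), character_eq_sum_inner (stdOrthonormalBasis ℂ F),
    map_sum, Finset.sum_mul_sum]
  rw [integral_finsetSum _ fun i _ => integrable_finsetSum _ fun k _ =>
    integrable_conj_inner_mul_inner μ hπ hσ _ _ _ _]
  refine Finset.sum_eq_zero fun i _ => ?_
  rw [integral_finsetSum _ fun k _ => integrable_conj_inner_mul_inner μ hπ hσ _ _ _ _]
  exact Finset.sum_eq_zero fun k _ => integral_conj_inner_mul_inner_eq_zero μ hπ hσ hne hu _ _ _ _

/-- **An irreducible unitary character has `L²`-norm one**: `∫ conj χ_π(g) χ_π(g) dμ(g) = 1` for irreducible unitary `π`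
(Bröcker–tom Dieck II (4.8) summed over an orthonormal basis: `Σ_{i,k} δ_{ik} δ_{ik} / dim E = 1`).
[cite: BrockerTomDieck1985, II (4.8)] -/
theorem integral_conj_character_mul_character (hπ : Continuous (π : G → E →L[ℂ] E))
    [π.toRepresentation.IsIrreducible] (hu : ∀ (g : G) (v w : E), ⟪π g v, π g w⟫_ℂ = ⟪v, w⟫_ℂ) :
    ∫ g, conj (character π g) * character π g ∂μ = 1 := by
  classical
  set b := stdOrthonormalBasis ℂ E with hb
  simp only [character_eq_sum_inner b, map_sum, Finset.sum_mul_sum]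
  rw [integral_finsetSum _ fun i _ => integrable_finsetSum _ fun k _ =>
    integrable_conj_inner_mul_inner μ hπ hπ _ _ _ _]
  have hik : ∀ i k, ∫ g, conj ⟪b i, π g (b i)⟫_ℂ * ⟪b k, π g (b k)⟫_ℂ ∂μ =
      if k = i then 1 / (Module.finrank ℂ E : ℂ) else 0 := by
    intro i k
    rw [integral_conj_coeff_mul_coeff μ b hπ hu k k i i]
    simp only [and_self]
  have hi : ∀ i, ∫ g, ∑ k, conj ⟪b i, π g (b i)⟫_ℂ * ⟪b k, π g (b k)⟫_ℂ ∂μ = 1 / (Module.finrank ℂ E : ℂ) := by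
    intro i
    rw [integral_finsetSum _ fun k _ => integrable_conj_inner_mul_inner μ hπ hπ _ _ _ _]
    simp_rw [hik]
    rw [Finset.sum_ite_eq' Finset.univ i, if_pos (Finset.mem_univ i)]
  simp_rw [hi]
  rw [Finset.sum_const, Finset.card_univ, Fintype.card_fin, nsmul_eq_mul, mul_one_div,
    div_self (finrank_ne_zero_of_isIrreducible π)]

end Schur

end Literature.RepresentationTheory.CompactGroups

end
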